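/-
Copyright (c) 2026. All rights reserved.
Released under Apache 2.0 license as described in the file LICENSE.
Authors: abc-iut cell, seat abc-iut-w5-d019 (gen 8).
-/
import Literature.GroupTheory.CommutatorWidthNilpotentNormal
import Literature.GroupTheory.CommutatorClosedOfBoundedWidth
import Mathlib.Algebra.Group.Subgroup.Pointwise
import Mathlib.Algebra.Group.Subgroup.ZPowers.Basic

/-!
# Commutator width of nilpotent-by-(abelian-by-cyclic) groups (the top layers of B. Hartley's
# width theorem for groups of Fitting height ≤ 3)

Let `G` be a group, `N ⊴ G`, and `A ⊴ G` a normal subgroup which is abelian modulo `⁅G, N⁆` (e.g.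
`A/N` cyclic: `commutator_le_commutator_top_of_le_sup_zpowers`) with `G/A` cyclic, generated by the
image of `s`.  Then (`commutator_subset_commSet_mul_commutator_top`)

  `[G, G] ⊆ {⁅a, s⁆ | a ∈ A} · ⁅G, N⁆`:

modulo `⁅G, N⁆` every element of the derived group is a SINGLE commutator `⁅a, s⁆` — in
`Ḡ = G/⁅G,N⁆` the subgroup `Ā` is abelian and normal with `Ḡ = Ā⟨s̄⟩`, and
`⁅a s^i, b s^j⁆ ≡ ⁅a, s^j⁆ ⁅b, s^i⁆⁻¹`, `⁅a, s^{j+1}⁆ = ⁅a, s^j⁆ · ⁅s^j a s^{-j}, s⁆`.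
Combined with the nilpotent layer (`CommutatorWidthNilpotentNormal.lean`: for `N` nilpotent, normally
generated by the entries of `v`, and `G` generated by the entries of `l`,
`⁅G, N⁆ = {⁅x₁,a₁⁆⋯⁅x_d,a_d⁆⁅y₁,b₁⁆⋯⁅y_e,b_e⁆}`), every element of `[G, G]` is a product of
`1 + d + e` commutators (`commutator_eq_commSet_mul_listProd`, `commutator_subset_powProd`):
a uniform version of B. Hartley, Math. Z. 168 (1979), Thm 2 (commutator width `≤ m + (2m−1)(c−1)` for
`m`-generated finite groups of Fitting height `c`; text not held — independent proof) in the case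
"nilpotent ⊴ (cyclic-by-cyclic quotient)", which is the shape of the Galois group of a finite Galois
extension of a non-archimedean local field (`G₁ ⊴ G₀ ⊴ Gal`, `G₁` a `p`-group, `G₀/G₁` and `Gal/G₀`
cyclic; Serre, *Corps locaux* IV §2).

Consumer (cell abc-iut, GAP-LEDGER G-L3d2g2-1): with `CommutatorClosedOfBoundedWidth.lean`, the
derived subgroup of every open subgroup of the absolute Galois group of a `p`-adic field is closed.
Classical group theory over Mathlib; no definition, no instance; nothing here bears on
[IUTchIII] Cor. 3.12 or asserts anything about abc.

[cite: DDMSAnalyticProP1999, Prop 1.19 (proof)] [cite: NikolovSegal2007, §1 (before Thm 1.6)]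
-/

namespace Literature.GroupTheory

namespace NilpotentByMetacyclicWidth

open scoped Pointwise commutatorElement

open NilpotentNormalWidth BoundedCommutatorWidth

variable {G : Type*} [Group G]

/-! ### Abelian-by-cyclic modulo `⁅G, N⁆`: one commutator -/

/-- Commutator of two elements of `Ā⟨S⟩`: if `S^i β S^{-i}` and `S^j α S^{-j}` commute then
`⁅α S^i, β S^j⁆ = ⁅α, S^j⁆ ⁅β, S^i⁆⁻¹` (pure group identity).
[cite: DDMSAnalyticProP1999, Prop 1.19 (proof)] -/
theorem commutatorElement_mul_zpow_mul_zpow {Q : Type*} [Group Q] (α β S : Q) (i j : ℤ)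
    (hc : Commute (S ^ i * β * S ^ (-i)) (S ^ j * α * S ^ (-j))) :
    ⁅α * S ^ i, β * S ^ j⁆ = ⁅α, S ^ j⁆ * ⁅β, S ^ i⁆⁻¹ := by
  have e1 : ⁅α * S ^ i, β * S ^ j⁆ =
      α * (S ^ i * β * S ^ (-i)) * (S ^ j * α * S ^ (-j))⁻¹ * β⁻¹ := by
    simp only [commutatorElement_def]; group
  have e2 : ⁅α, S ^ j⁆ * ⁅β, S ^ i⁆⁻¹ =
      α * (S ^ j * α * S ^ (-j))⁻¹ * (S ^ i * β * S ^ (-i)) * β⁻¹ := by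
    simp only [commutatorElement_def]; group
  rw [e1, e2, mul_assoc α (S ^ i * β * S ^ (-i)), hc.inv_right.eq, ← mul_assoc]

/-- If `A ≤ N ⊔ ⟨t⟩` ("`A/N` cyclic") with `N ⊴ G`, then `⁅A, A⁆ ≤ ⁅G, N⁆`: modulo `⁅G, N⁆` the
elements of `N` are central, so `⁅n tⁱ, n' tʲ⁆ ≡ ⁅tⁱ, tʲ⁆ = 1`.
[cite: DDMSAnalyticProP1999, Prop 1.19 (proof)] -/
theorem commutator_le_commutator_top_of_le_sup_zpowers (N A : Subgroup G) [N.Normal] {t : G}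
    (hAt : A ≤ N ⊔ Subgroup.zpowers t) : ⁅A, A⁆ ≤ ⁅(⊤ : Subgroup G), N⁆ := by
  rw [Subgroup.commutator_le]
  intro a ha b hb
  obtain ⟨n, hn, z, hz, rfl⟩ := Subgroup.mem_sup_of_normal_left.mp (hAt ha)
  obtain ⟨n', hn', z', hz', rfl⟩ := Subgroup.mem_sup_of_normal_left.mp (hAt hb)
  obtain ⟨i, rfl⟩ := Subgroup.mem_zpowers_iff.mp hz
  obtain ⟨j, rfl⟩ := Subgroup.mem_zpowers_iff.mp hz'
  -- centrality of `N` modulo `⁅G, N⁆`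
  have hcen : ∀ m ∈ N, ∀ q : G ⧸ ⁅(⊤ : Subgroup G), N⁆,
      Commute (QuotientGroup.mk' ⁅(⊤ : Subgroup G), N⁆ m) q := by
    intro m hm q
    induction q using QuotientGroup.induction_on with
    | H g =>
      refine commute_mk_of_commutator_mem ?_
      rw [Subgroup.commutator_comm]
      exact Subgroup.commutator_mem_commutator hm (Subgroup.mem_top g)
  rw [← QuotientGroup.eq_one_iff]
  change QuotientGroup.mk' ⁅(⊤ : Subgroup G), N⁆ ⁅n * t ^ i, n' * t ^ j⁆ = 1
  simp only [map_commutatorElement, map_mul, map_zpow]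
  have h1 : ⁅QuotientGroup.mk' ⁅(⊤ : Subgroup G), N⁆ n * QuotientGroup.mk' ⁅(⊤ : Subgroup G), N⁆ t ^ i,
      QuotientGroup.mk' ⁅(⊤ : Subgroup G), N⁆ n' * QuotientGroup.mk' ⁅(⊤ : Subgroup G), N⁆ t ^ j⁆ =
      ⁅QuotientGroup.mk' ⁅(⊤ : Subgroup G), N⁆ t ^ i,
        QuotientGroup.mk' ⁅(⊤ : Subgroup G), N⁆ n' * QuotientGroup.mk' ⁅(⊤ : Subgroup G), N⁆ t ^ j⁆ := by
    rw [commutatorElement_mul_left_eq_conj_mul, (hcen n hn _).commutator_eq, mul_one,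
      (hcen n hn _).eq, mul_inv_cancel_right]
  have h2 : ⁅QuotientGroup.mk' ⁅(⊤ : Subgroup G), N⁆ t ^ i,
      QuotientGroup.mk' ⁅(⊤ : Subgroup G), N⁆ n' * QuotientGroup.mk' ⁅(⊤ : Subgroup G), N⁆ t ^ j⁆ =
      ⁅QuotientGroup.mk' ⁅(⊤ : Subgroup G), N⁆ t ^ i, QuotientGroup.mk' ⁅(⊤ : Subgroup G), N⁆ t ^ j⁆ := by
    rw [commutatorElement_mul_right_eq_mul_conj, (hcen n' hn' _).symm.commutator_eq, one_mul,
      (hcen n' hn' _).eq, mul_inv_cancel_right]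
  rw [h1, h2]
  exact ((Commute.refl _).zpow_zpow i j).commutator_eq

/-- **Top layer.** Let `N ⊴ G` and `A ⊴ G` with `⁅A, A⁆ ≤ ⁅G, N⁆` (`A` abelian modulo `⁅G, N⁆`; e.g.
`A/N` cyclic) and `A ⊔ ⟨s⟩ = G` (`G/A` cyclic).  Then `[G, G] ⊆ {⁅a, s⁆ | a ∈ A} · ⁅G, N⁆`: modulo
`⁅G, N⁆` every element of the derived group is a single commutator `⁅a, s⁆`, `a ∈ A`.
[cite: DDMSAnalyticProP1999, Prop 1.19 (proof)] -/
theorem commutator_subset_commSet_mul_commutator_top (N A : Subgroup G) [N.Normal] [A.Normal]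
    (hA : ⁅A, A⁆ ≤ ⁅(⊤ : Subgroup G), N⁆) {s : G} (hs : A ⊔ Subgroup.zpowers s = ⊤) :
    (commutator G : Set G) ⊆
      ((fun a : G => ⁅a, s⁆) '' (A : Set G)) * ((⁅(⊤ : Subgroup G), N⁆ : Subgroup G) : Set G) := by
  -- the subgroup `Y = {⁅a, s⁆} · ⁅G, N⁆`
  have hC : ∀ x ∈ A, ∀ c ∈ A, ⁅c, x⁆ ∈ ⁅(⊤ : Subgroup G), N⁆ :=
    fun x hx c hc => hA (Subgroup.commutator_mem_commutator hc hx)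
  have hw : ∀ p ∈ [(s, A)], p.2 ≤ A ∧ ∀ y ∈ p.2, ⁅y, p.1⁆ ∈ A := by
    intro p hp
    rw [List.mem_singleton] at hp
    subst hp
    exact ⟨le_rfl, fun y hy => commutatorElement_mem_left hy s⟩
  obtain ⟨Y, hY⟩ :=
    exists_subgroup_coe_eq_listProd_mul (D := ⁅(⊤ : Subgroup G), N⁆) A A le_rfl hC hw
  rw [List.map_cons, List.map_nil, List.prod_cons, List.prod_nil, mul_one] at hY
  -- `hY : ↑Y = {⁅a, s⁆ | a ∈ A} * ⁅G, N⁆`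
  have hMY : ⁅(⊤ : Subgroup G), N⁆ ≤ Y := fun d hd => by
    rw [← SetLike.mem_coe, hY]
    exact Set.mem_mul.mpr ⟨1, ⟨1, A.one_mem, commutatorElement_one_left s⟩, d, hd, one_mul d⟩
  have hTY : ∀ a ∈ A, ⁅a, s⁆ ∈ Y := fun a ha => by
    rw [← SetLike.mem_coe, hY]
    exact Set.mem_mul.mpr ⟨⁅a, s⁆, ⟨a, ha, rfl⟩, 1, Subgroup.one_mem _, mul_one _⟩
  have hYmk : ∀ {g g' : G}, QuotientGroup.mk' ⁅(⊤ : Subgroup G), N⁆ g =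
      QuotientGroup.mk' ⁅(⊤ : Subgroup G), N⁆ g' → g' ∈ Y → g ∈ Y := by
    intro g g' hgg' hg'
    rw [QuotientGroup.mk'_apply, QuotientGroup.mk'_apply] at hgg'
    have h : g⁻¹ * g' ∈ ⁅(⊤ : Subgroup G), N⁆ := QuotientGroup.eq.mp hgg'
    have : g = g' * (g⁻¹ * g')⁻¹ := by group
    rw [this]
    exact Y.mul_mem hg' (Y.inv_mem (hMY h))
  have hconjA : ∀ (g : G) {a : G}, a ∈ A → g * a * g⁻¹ ∈ A :=
    fun g a ha => Subgroup.Normal.conj_mem inferInstance a ha g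
  -- `⁅a, s⁻¹⁆ ∈ Y`, and then `⁅a, s^j⁆ ∈ Y` for all `j : ℤ`
  have hinv : ∀ a ∈ A, ⁅a, s⁻¹⁆ ∈ Y := by
    intro a ha
    have h1 : ⁅a, s⁻¹⁆ = (⁅s⁻¹ * a * s⁻¹⁻¹, s⁆)⁻¹ := by
      simp only [commutatorElement_def]; group
    rw [h1]
    exact Y.inv_mem (hTY _ (hconjA s⁻¹ ha))
  have hzpow : ∀ (j : ℤ), ∀ a ∈ A, ⁅a, s ^ j⁆ ∈ Y := by
    intro j
    induction j with
    | zero =>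
      intro a _
      rw [zpow_zero, commutatorElement_one_right]
      exact Y.one_mem
    | succ i ih =>
      intro a ha
      have e : ⁅a, s ^ ((i : ℤ) + 1)⁆ =
          ⁅a, s ^ (i : ℤ)⁆ * ⁅s ^ (i : ℤ) * a * (s ^ (i : ℤ))⁻¹, s⁆ := by
        simp only [commutatorElement_def]; group
      rw [e]
      exact Y.mul_mem (ih a ha) (hTY _ (hconjA _ ha))
    | pred i ih =>
      intro a ha
      have e : ⁅a, s ^ (-(i : ℤ) - 1)⁆ =
          ⁅a, s ^ (-(i : ℤ))⁆ * ⁅s ^ (-(i : ℤ)) * a * (s ^ (-(i : ℤ)))⁻¹, s⁻¹⁆ := by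
        simp only [commutatorElement_def]; group
      rw [e]
      exact Y.mul_mem (ih a ha) (hinv _ (hconjA _ ha))
  -- every commutator lies in `Y`
  have key : ∀ g h : G, ⁅g, h⁆ ∈ Y := by
    intro g h
    have hg : g ∈ A ⊔ Subgroup.zpowers s := by rw [hs]; exact Subgroup.mem_top g
    have hh : h ∈ A ⊔ Subgroup.zpowers s := by rw [hs]; exact Subgroup.mem_top h
    obtain ⟨a, ha, z, hz, rfl⟩ := Subgroup.mem_sup_of_normal_left.mp hg
    obtain ⟨b, hb, z', hz', rfl⟩ := Subgroup.mem_sup_of_normal_left.mp hh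
    obtain ⟨i, rfl⟩ := Subgroup.mem_zpowers_iff.mp hz
    obtain ⟨j, rfl⟩ := Subgroup.mem_zpowers_iff.mp hz'
    refine hYmk ?_ (Y.mul_mem (hzpow j a ha) (Y.inv_mem (hzpow i b hb)))
    have hbi : s ^ i * b * s ^ (-i) ∈ A := by rw [zpow_neg]; exact hconjA _ hb
    have haj : s ^ j * a * s ^ (-j) ∈ A := by rw [zpow_neg]; exact hconjA _ ha
    have hc0 := commute_mk_of_commutator_mem (D := ⁅(⊤ : Subgroup G), N⁆) (hC _ haj _ hbi)
    simp only [map_mul, map_zpow] at hc0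
    simp only [map_commutatorElement, map_mul, map_inv, map_zpow]
    exact commutatorElement_mul_zpow_mul_zpow _ _ _ i j hc0
  -- conclusion
  have hle : commutator G ≤ Y := by
    rw [commutator, Subgroup.commutator_le]
    exact fun g _ h _ => key g h
  rw [← hY]
  exact SetLike.coe_subset_coe.mpr hle

/-! ### Nilpotent-by-(abelian-by-cyclic): `1 + d + e` commutators -/

/-- **Commutator width of nilpotent-by-(abelian-by-cyclic) groups.**  Let `N ⊴ G` be NILPOTENT and the
normal closure of the entries `b₁, …, b_e ∈ N` of `v`; let the entries `a₁, …, a_d` of `l` generate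
`G`; let `A ⊴ G` be abelian modulo `⁅G, N⁆` (e.g. `A/N` cyclic) with `A ⊔ ⟨s⟩ = G`.  Then
`[G, G] = {⁅a, s⁆ | a ∈ A} · {⁅x₁,a₁⁆⋯⁅x_d,a_d⁆⁅y₁,b₁⁆⋯⁅y_e,b_e⁆ | xᵢ, yⱼ ∈ N}`; in particular
every element of `[G, G]` is a product of `1 + d + e` commutators.
[cite: DDMSAnalyticProP1999, Prop 1.19 (proof)] -/
theorem commutator_eq_commSet_mul_listProd (N A : Subgroup G) [N.Normal] [A.Normal]
    [Group.IsNilpotent N] (hA : ⁅A, A⁆ ≤ ⁅(⊤ : Subgroup G), N⁆) {s : G}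
    (hs : A ⊔ Subgroup.zpowers s = ⊤) {l : List G} (hl : Subgroup.closure {a : G | a ∈ l} = ⊤)
    {v : List G} (hv : ∀ b ∈ v, b ∈ N) (hN : N ≤ Subgroup.normalClosure {b : G | b ∈ v}) :
    (commutator G : Set G) =
      ((fun a : G => ⁅a, s⁆) '' (A : Set G)) *
        (((l ++ v).map fun a => (a, N)).map fun p : G × Subgroup G =>
          (fun y : G => ⁅y, p.1⁆) '' (p.2 : Set G)).prod := by
  rw [← commutator_top_eq_listProd_of_isNilpotent N hl hv hN]
  refine Set.Subset.antisymm (commutator_subset_commSet_mul_commutator_top N A hA hs) ?_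
  rintro g hg
  obtain ⟨c, ⟨a, _, rfl⟩, m, hm, rfl⟩ := Set.mem_mul.mp hg
  exact (commutator G).mul_mem
    (Subgroup.commutator_mem_commutator (Subgroup.mem_top a) (Subgroup.mem_top s))
    (Subgroup.commutator_mono le_top le_top hm)

/-- **Commutator width `≤ 1 + d + e`** for nilpotent-by-(abelian-by-cyclic) groups, in the
`C_B = (replicate B {⁅x,y⁆}).prod` shape of `CommutatorClosedOfBoundedWidth.lean`.
[cite: DDMSAnalyticProP1999, Prop 1.19 (proof)] -/
theorem commutator_subset_powProd (N A : Subgroup G) [N.Normal] [A.Normal]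
    [Group.IsNilpotent N] (hA : ⁅A, A⁆ ≤ ⁅(⊤ : Subgroup G), N⁆) {s : G}
    (hs : A ⊔ Subgroup.zpowers s = ⊤) {l : List G} (hl : Subgroup.closure {a : G | a ∈ l} = ⊤)
    {v : List G} (hv : ∀ b ∈ v, b ∈ N) (hN : N ≤ Subgroup.normalClosure {b : G | b ∈ v}) :
    (commutator G : Set G) ⊆
      (List.replicate ((l ++ v).length + 1) {c : G | ∃ x y : G, ⁅x, y⁆ = c}).prod := by
  rw [commutator_eq_commSet_mul_listProd N A hA hs hl hv hN, List.replicate_succ, List.prod_cons]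
  refine Set.mul_subset_mul ?_ ?_
  · rintro c ⟨a, _, rfl⟩
    exact ⟨a, s, rfl⟩
  · have h := listProd_commSet_subset_powProd ((l ++ v).map fun a => (a, N))
    rwa [List.length_map] at h

end NilpotentByMetacyclicWidth

end Literature.GroupTheory
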